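import Literature.Barriers.CriticalPhenomena.PositionSpaceRGNonGibbsianSpacingSelectionProofs
import Literature.Barriers.CriticalPhenomena.PositionSpaceRGNonGibbsianHolds
import Literature.Barriers.CriticalPhenomena.PositionSpaceRGNonGibbsianThm41Step2
import HarnessLib

/-!
# Barrier `PositionSpaceRGNonGibbsian`, Theorem 4.3 (decimation with spacing `b ≥ 2`): what is
# left is exactly the Pirogov–Sinai step for `b ≥ 3`

Companion file of `Literature/Barriers/CriticalPhenomena/PositionSpaceRGNonGibbsian.lean` on the
Theorem 4.3 line (van Enter–Fernández–Sokal, J. Stat. Phys. **72** (1993) 879,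
arXiv:hep-lat/9210032, §4.3.2). The tree now contains, all proved:

* the chain `VEFS1993_screening → VEFS1993_plusPhase → VEFS1993_eq413_extremal
  ↔ VEFS1993_eq413_spacing → VEFS1993_eq432_spacing → VEFS1993_thm43`
  (`…SpacingSelection.lean`, `…Extremal.lean`, `…Spacing.lean`);
* the discharge `VEFS1993_screening_holds` (§4.3.1 Steps 2.1–2.2 for every spacing,
  `…SpacingSelectionProofs.lean`);
* Theorem 4.1 (`VEFS1993_thm41_holds`, `…Thm41Step2.lean`: `d = 2`, `b = 2`, `J > ½ cosh⁻¹(1+√2)`)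
  and Theorem 4.2 (`VEFS1993_thm42_holds`, `…Holds.lean`: `d ≥ 3`, `b = 2`, `J > J_{c,d-1}`).

Here these are assembled POINTWISE in `(d, b)`, which the global (`∀ d b`) shape of the named facts
hides: (i) for fixed `d ≥ 2`, `b ≥ 2`, the plus-phase bound at `(d, b)` alone — the finite-volume
form of §4.3.1 Steps 2.3–2.4 with Step 3, "`μ^{(+)}_{∞;±}(σ_i) ≥ c > 0`", i.e. the content of
§4.3.2 / App. B.5.3 (Pirogov–Sinai theory for the internal spins with fully alternating image
spins) — gives Theorem 4.3 at `(d, b)` (`not_isQuasilocalMeasure_decimate_of_plusPhaseAt`);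
(ii) at `b = 2` Theorem 4.3 is Theorem 4.1 (`d = 2`) or Theorem 4.2 (`d ≥ 3`), both proved, so it
holds outright (`VEFS1993_thm43At_two`; §4.3.2: "The conclusions of Theorem 4.2 for decimation with
spacing `b = 2` hold also for larger spacings"); hence (iii) the named fact `VEFS1993_thm43` follows
from the plus-phase bound for spacings `b ≥ 3` ONLY (`VEFS1993_thm43_of_plusPhase_three_le`), and of
course from `VEFS1993_plusPhase` itself (`VEFS1993_thm43_of_plusPhase`).

What remains for `VEFS1993_thm43_holds` is therefore precisely the low-temperature phase transition
of the internal-spin system with fully alternating image spins for `b ≥ 3` (§4.3.2: "for `b ≥ 3`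
the system of internal spins obtained with `ω' = ω'_alt` … contains a periodic alternating magnetic
field which is nonzero at the sites neighboring an image spin. As a consequence, we need a more
sophisticated technique to conclude that there is indeed a phase transition (Step 1). The
appropriate tool for this purpose is Pirogov–Sinai theory"), in the finite-volume form
`VEFS1993_plusPhase` restricted to `b ≥ 3`.

Nothing is asserted: the file is sorry-free and introduces no named fact (D-0014, D-0026).

## References

* A. C. D. van Enter, R. Fernández, A. D. Sokal, J. Stat. Phys. 72 (1993) 879–1167,
  arXiv:hep-lat/9210032 — Theorems 4.1–4.3, §4.3.1 Step 2 (4.26)–(4.27), §4.3.2, App. B.5.3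
  [VanenterFernandezSokal1993].
-/

noncomputable section

namespace Literature.Barriers.CriticalPhenomena.NonGibbs

open MeasureTheory Literature.Probability.LatticeModels

variable {d : ℕ}

/-! ### The chain at a fixed `(d, b)` -/

/-- **Theorem 4.3 at `(d, b)` from the uniform finite-volume estimate at `(d, b, β)`** (the
pointwise form of `VEFS1993_thm43_of_eq413`: Step 0 by the DLR equations in the volume `W`, then
the Griffiths–Pearce–Israel conclusion at `ω'_alt`): if for some `δ > 0` every `R` admits `R' > R`,
a volume `W ∋ 0` free of other image sites and levels `c₊ - c₋ ≥ δ` bounding `⟨σ_0⟩^η_{W;β,0}`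
from below on `T_b⁻¹𝒩_{R,R',+}` and from above on `T_b⁻¹𝒩_{R,R',-}`, then `μT_b` is consistent
with no quasilocal specification, for every zero-field Ising Gibbs measure `μ` at `β`.
[cite: VanenterFernandezSokal1993, §4.1.2 Step 0, §4.3.1 eq. (4.32) and §4.3.2] -/
theorem not_isQuasilocalMeasure_decimate_of_gapAt {b : ℕ} (hb : 0 < b) {β δ : ℝ} (hδ : 0 < δ)
    (hR : ∀ R : ℕ, ∃ R' : ℕ, R < R' ∧ ∃ W : Finset (Site d), (0 : Site d) ∈ W ∧
      (∀ x : Site d, x ≠ 0 → (fun i => (b : ℤ) * x i) ∉ W) ∧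
      ∃ cplus cminus : ℝ, δ ≤ cplus - cminus ∧
        (∀ η : SpinConfig (Site d), decimate d b η ∈ plusSelected d R R' →
          cplus ≤ isingExpect (zdGraph d) W β 0 (.fixed η) (spinAt 0)) ∧
        (∀ η : SpinConfig (Site d), decimate d b η ∈ minusSelected d R R' →
          isingExpect (zdGraph d) W β 0 (.fixed η) (spinAt 0) ≤ cminus))
    {μ : Measure (SpinConfig (Site d))} (hμ : μ ∈ isingGibbsMeasures d β 0) :
    ¬ IsQuasilocalMeasure (μ.map (decimate d b)) := by
  choose R' hRR' W h0 hW cplus cminus hgap hplus hminus using hR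
  exact not_isQuasilocalMeasure_of_gap (fun R => plusSelected d R (R' R))
    (fun R => minusSelected d R (R' R)) (fun R ω hω => eqOn_box_of_mem_plusSelected hω)
    (fun R ω hω => eqOn_box_of_mem_minusSelected hω)
    (fun R => (map_decimate_plusSelected_pos_spacing hb hμ R (R' R)).ne')
    (fun R => (map_decimate_minusSelected_pos_spacing hb hμ R (R' R)).ne') hδ cplus cminus hgap
    (fun R => ae_le_condExpSpinAtOrigin_of_forall_isingExpect hb hμ (h0 R) (hW R) (hplus R))
    (fun R => ae_condExpSpinAtOrigin_le_of_forall_isingExpect hb hμ (h0 R) (hW R) (hminus R))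

/-- **The FKG step at `(d, b, β)`** (pointwise form of `VEFS1993_eq413_spacing_of_extremal`): for
`β ≥ 0`, a gap `δ` between the two EXTREMAL boundary conditions of (4.26)–(4.27) gives the levels
`c₊ = ⟨σ_0⟩^{±,+,-}_W`, `c₋ = ⟨σ_0⟩^{±,-,+}_W` uniformly over all boundary conditions selected by
`𝒩_{R,R',±}` (monotonicity of `⟨σ_0⟩^η_W` in `η`, Friedli–Velenik Lemma 3.23 / Exercise 3.13).
[cite: VanenterFernandezSokal1993, §4.3.1 eqs. (4.26)–(4.27)] -/
theorem gapAt_of_extremalGapAt {b : ℕ} (hb : 0 < b) {β : ℝ} (hβ : 0 ≤ β) {δ : ℝ} {R R' : ℕ}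
    {W : Finset (Site d)}
    (hgap : δ ≤ isingExpect (zdGraph d) W β 0 (.fixed (coreAnnulusBC d b R R' 1 (-1))) (spinAt 0) -
      isingExpect (zdGraph d) W β 0 (.fixed (coreAnnulusBC d b R R' (-1) 1)) (spinAt 0)) :
    ∃ cplus cminus : ℝ, δ ≤ cplus - cminus ∧
      (∀ η : SpinConfig (Site d), decimate d b η ∈ plusSelected d R R' →
        cplus ≤ isingExpect (zdGraph d) W β 0 (.fixed η) (spinAt 0)) ∧
      (∀ η : SpinConfig (Site d), decimate d b η ∈ minusSelected d R R' →
        isingExpect (zdGraph d) W β 0 (.fixed η) (spinAt 0) ≤ cminus) :=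
  ⟨_, _, hgap,
    fun _ hη => isingExpect_fixed_mono (zdGraph d) hβ W 0 (coreAnnulusBC_le_of_mem_plusSelected hb hη)
      (spinAt_mono 0) (measurable_spinAt 0),
    fun _ hη => isingExpect_fixed_mono (zdGraph d) hβ W 0 (le_coreAnnulusBC_of_mem_minusSelected hb hη)
      (spinAt_mono 0) (measurable_spinAt 0)⟩

/-- **The extremal gap at `(d, b, β, R)` from screening and the plus phase at `(d, b, β)`**
(pointwise form of `VEFS1993_eq413_extremal_of_screening_plusPhase`, §4.3.1 Step 2: the `-` side of
(4.27) is the spin flip of a `+`-annulus system of the other parity, the `+` exterior is compared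
with the `-` exterior by screening at `ε = c/2`, and the `+` annulus is lowered to the alternating
pattern by FKG monotonicity in the boundary condition): in the volume `W(R') = Λ^int_{R'} ∪ {0}`,
`⟨σ_0⟩^{±,+,-}_{W(R')} - ⟨σ_0⟩^{±,-,+}_{W(R')} ≥ c` for a suitable `R' > R`.
[cite: VanenterFernandezSokal1993, §4.3.1 Step 2 eqs. (4.26)–(4.27) and §4.3.2] -/
theorem extremalGapAt_of_screeningAt_plusPhaseAt {b : ℕ} {β c : ℝ} (hβ : 0 ≤ β) (hc : 0 < c)
    (hS : ∀ p : ℤˣ, ∀ R : ℕ, ∀ ε : ℝ, 0 < ε → ∃ R₀ : ℕ, ∀ R' : ℕ, R₀ ≤ R' →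
      isingExpect (zdGraph d) (spacingVolume d b R') β 0
          (.fixed (signedCoreAnnulusBC d b p R R' 1 1)) (spinAt 0) ≤
        isingExpect (zdGraph d) (spacingVolume d b R') β 0
          (.fixed (signedCoreAnnulusBC d b p R R' 1 (-1))) (spinAt 0) + ε)
    (hP : ∀ p : ℤˣ, ∀ R' : ℕ, c ≤ isingExpect (zdGraph d) (spacingVolume d b R') β 0
      (.fixed (signedCoreAnnulusBC d b p R' R' 1 1)) (spinAt 0)) (R : ℕ) :
    ∃ R' : ℕ, R < R' ∧
      c ≤ isingExpect (zdGraph d) (spacingVolume d b R') β 0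
          (.fixed (coreAnnulusBC d b R R' 1 (-1))) (spinAt 0) -
        isingExpect (zdGraph d) (spacingVolume d b R') β 0
          (.fixed (coreAnnulusBC d b R R' (-1) 1)) (spinAt 0) := by
  obtain ⟨R₁, hR₁⟩ := hS 1 R (c / 2) (half_pos hc)
  obtain ⟨R₂, hR₂⟩ := hS (-1) R (c / 2) (half_pos hc)
  set R' : ℕ := max (max R₁ R₂) (R + 1) with hR'def
  have hRR' : R < R' := by omega
  have h₁ : R₁ ≤ R' := by omega
  have h₂ : R₂ ≤ R' := by omega
  refine ⟨R', hRR', ?_⟩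
  -- the `+` side, parity `p = 1`
  have hplus : c - c / 2 ≤ isingExpect (zdGraph d) (spacingVolume d b R') β 0
      (.fixed (coreAnnulusBC d b R R' 1 (-1))) (spinAt 0) := by
    rw [← signedCoreAnnulusBC_one]
    exact sub_le_isingExpect_minusExterior hβ hRR'.le (hP 1 R') (hR₁ R' h₁)
  -- the `-` side is the flip of the parity `p = -1` system
  have hneg : coreAnnulusBC d b R R' (-1) 1 = -signedCoreAnnulusBC d b (-1) R R' 1 (-1) := by
    have := neg_coreAnnulusBC (d := d) b R R' (-1) 1
    rw [neg_neg] at this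
    rw [← this, neg_neg]
  have hminus : isingExpect (zdGraph d) (spacingVolume d b R') β 0
      (.fixed (coreAnnulusBC d b R R' (-1) 1)) (spinAt 0) ≤ -(c - c / 2) := by
    rw [hneg, isingExpect_spinAt_zero_fixed_neg]
    have := sub_le_isingExpect_minusExterior hβ hRR'.le (hP (-1) R') (hR₂ R' h₂)
    linarith
  linarith

/-- **Theorem 4.3 at `(d, b)` from the plus-phase bound at `(d, b)` alone** (`d ≥ 2`, `b ≥ 2`):
screening is proved for every spacing (`VEFS1993_screening_holds`, §4.3.1 Steps 2.1–2.2), so the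
finite-volume plus-phase bound of §4.3.1 Steps 2.3–2.4 with Step 3 — "`μ^{(+)}_{∞;±}(σ_i) ≥ c > 0`",
for `b ≥ 3` the Pirogov–Sinai content of §4.3.2 / App. B.5.3 — is all that Theorem 4.3 needs at
that `(d, b)`: threshold `J₀ = max(J₁(d,b), J₂, 0)`.
[cite: VanenterFernandezSokal1993, Theorem 4.3, §4.3.1 Step 2 and §4.3.2] -/
theorem not_isQuasilocalMeasure_decimate_of_plusPhaseAt {b : ℕ} (hd : 2 ≤ d) (hb : 2 ≤ b)
    {J₂ : ℝ}
    (hP : ∀ β : ℝ, J₂ < β → ∃ c : ℝ, 0 < c ∧ ∀ p : ℤˣ, ∀ R' : ℕ,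
      c ≤ isingExpect (zdGraph d) (spacingVolume d b R') β 0
        (.fixed (signedCoreAnnulusBC d b p R' R' 1 1)) (spinAt 0)) :
    ∃ J₀ : ℝ, ∀ β : ℝ, J₀ < β →
      ∀ μ ∈ isingGibbsMeasures d β 0, ¬ IsQuasilocalMeasure (μ.map (decimate d b)) := by
  obtain ⟨J₁, hJ₁⟩ := VEFS1993_screening_holds d b hd hb
  refine ⟨max (max J₁ J₂) 0, fun β hβ μ hμ => ?_⟩
  have hβ₁ : J₁ < β := lt_of_le_of_lt ((le_max_left _ _).trans (le_max_left _ _)) hβ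
  have hβ₂ : J₂ < β := lt_of_le_of_lt ((le_max_right _ _).trans (le_max_left _ _)) hβ
  have hβ0 : 0 ≤ β := (le_max_right _ 0).trans hβ.le
  have hb0 : 0 < b := by omega
  obtain ⟨c, hc, hcP⟩ := hP β hβ₂
  refine not_isQuasilocalMeasure_decimate_of_gapAt hb0 hc (fun R => ?_) hμ
  obtain ⟨R', hRR', hgap⟩ :=
    extremalGapAt_of_screeningAt_plusPhaseAt hβ0 hc (hJ₁ β hβ₁) hcP R
  exact ⟨R', hRR', spacingVolume d b R', zero_mem_spacingVolume b R',
    fun x hx => image_notMem_spacingVolume hb0 R' hx, gapAt_of_extremalGapAt hb0 hβ0 hgap⟩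

/-! ### Spacing `b = 2`: Theorems 4.1 and 4.2 -/

/-- **Theorem 4.3 at spacing `b = 2` holds outright** (§4.3.2: "The conclusions of Theorem 4.2 for
decimation with spacing `b = 2` hold also for larger spacings"): for `d = 2` it is Theorem 4.1
(`VEFS1993_thm41_holds`, threshold `½ cosh⁻¹(1+√2)`), for `d ≥ 3` Theorem 4.2
(`VEFS1993_thm42_holds`, threshold `J_{c,d-1}`), both proved in the tree.
[cite: VanenterFernandezSokal1993, Theorems 4.1–4.3] -/
theorem VEFS1993_thm43At_two (hd : 2 ≤ d) :
    ∃ J₀ : ℝ, ∀ β : ℝ, J₀ < β →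
      ∀ μ ∈ isingGibbsMeasures d β 0, ¬ IsQuasilocalMeasure (μ.map (decimate d 2)) := by
  rcases Nat.eq_or_lt_of_le hd with h2 | h3
  · subst h2
    exact ⟨israelThreshold, VEFS1993_thm41_holds⟩
  · exact ⟨criticalBeta (d - 1), VEFS1993_thm42_holds d h3⟩

/-! ### The named fact from the plus phase -/

/-- **Theorem 4.3 from the plus phase**: with screening discharged, `VEFS1993_plusPhase` alone
implies `VEFS1993_thm43` (through the accepted glue `VEFS1993_thm43_of_screening_plusPhase`).
[cite: VanenterFernandezSokal1993, Theorem 4.3 and §4.3.2] -/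
theorem VEFS1993_thm43_of_plusPhase (hP : VEFS1993_plusPhase) : VEFS1993_thm43 :=
  VEFS1993_thm43_of_screening_plusPhase VEFS1993_screening_holds hP

/-- **Theorem 4.3 from the plus-phase bound for spacings `b ≥ 3` only** — the exact remaining
content: the low-temperature `+` phase of the internal-spin system with fully alternating image
spins for `b ≥ 3` (§4.3.2, App. B.5.3: "for the fully alternating block-spin configuration, the
system of internal spins has only two periodic ground states … these ground states satisfy the
Peierls condition. It follows from P–S theory that at low temperature there are precisely two
periodic Gibbs measures"), in the finite-volume form of `VEFS1993_plusPhase`: with all image spins of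
`Λ_{R'}` alternating (either parity `p`) and all-`+` exterior, `⟨σ_0⟩_{W(R');β,0} ≥ c(β,d,b) > 0`
uniformly in `R'`, for `β > J₂(d,b)`. Spacing `2` is covered by Theorems 4.1–4.2
(`VEFS1993_thm43At_two`). [cite: VanenterFernandezSokal1993, Theorem 4.3, §4.3.2 and App. B.5.3] -/
theorem VEFS1993_thm43_of_plusPhase_three_le
    (hP3 : ∀ d b : ℕ, 2 ≤ d → 3 ≤ b → ∃ J₂ : ℝ, ∀ β : ℝ, J₂ < β → ∃ c : ℝ, 0 < c ∧
      ∀ p : ℤˣ, ∀ R' : ℕ, c ≤ isingExpect (zdGraph d) (spacingVolume d b R') β 0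
        (.fixed (signedCoreAnnulusBC d b p R' R' 1 1)) (spinAt 0)) :
    VEFS1993_thm43 := by
  intro d b hd hb
  rcases Nat.eq_or_lt_of_le hb with h2 | h3
  · subst h2
    exact VEFS1993_thm43At_two hd
  · obtain ⟨J₂, hJ₂⟩ := hP3 d b hd h3
    exact not_isQuasilocalMeasure_decimate_of_plusPhaseAt hd hb hJ₂

/-- In particular, for every `d ≥ 2` the spacing-`2` decimation step fails to act on Hamiltonians
beyond a threshold, unconditionally (the technique class `RenormalizedHamiltonianExists` fails at
every `(β, 0)`, `β > J₀(d, 2)`). [cite: VanenterFernandezSokal1993, Theorems 4.1–4.2 and Definition 3.1] -/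
theorem exists_not_renormalizedHamiltonianExists_decimate_two (hd : 2 ≤ d) :
    ∃ J₀ : ℝ, ∀ β : ℝ, J₀ < β → ¬ RenormalizedHamiltonianExists d (decimate d 2) β 0 := by
  obtain ⟨J₀, hJ⟩ := VEFS1993_thm43At_two (d := d) hd
  refine ⟨J₀, fun β hβ => ?_⟩
  rintro ⟨μ, hμ, hq⟩
  exact hJ β hβ μ hμ hq

end Literature.Barriers.CriticalPhenomena.NonGibbs

end
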